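import Mathlib
import Summits.Ventures.PercRepro.TriangleCapMaxDegreeGen

/-!
# PercRepro — THE DEGREE ARGUMENT AT EVERY LEVEL `a` (p3, gen 40; part 159)

The three steps of parts 147–157 with the row index `a` as a parameter, on the cell `m = a (k − a) − r`
(`m + a² + r = a k`), under the max-degree cap `d(v) ≤ k − a` of part 158:
* `band_stability_of_min_degree`: every degree `≥ a` ⇒ `Σ_v d(v)² ≤ k (2m − ak) + a² k`
  (`Σ (d − a)² ≤ (k − 2a) Σ (d − a)`), which is `mk − r(k − 1 − r) − r(r + 1)`;
* `band_of_low_degree`: a vertex `z` of degree `d ≤ a − 1` with `r + d ≥ a`, deleted onto the cell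
  `r + d − a` of the same row at `k − 1` — with `Σ_{x ∼ z} d_{D−z}(x) ≤ d (k − a − 1)` the slack is
  `(a − 1 − d)(r − a + d) ≥ 0`;
* `band_of_low_degree_cross`: a vertex of degree `d` with `r + d ≤ a − 1`, deleted onto the ENVELOPE at `k − 1`
  (`Σ ≤ m' (k − 1)`, part 119): the slack `(a − r − d) k − a² + r² + 2ad − d² ≥ a + d > 0`.
Axioms: standard.
-/

namespace PercRepro

namespace TriangleCap

namespace C047

open Finset

variable {V : Type*} [Fintype V] [DecidableEq V]

/-- The middle term of the deletion identity: `Σ_{x ∼ z} d_{D−z}(x) ≤ d(z) · c` when every degree is `≤ c + 1`. -/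
theorem sum_del_nbhd_le (D : SimpleGraph V) [DecidableRel D.Adj] (z : V) (c : ℕ)
    (hcap : ∀ v, deg D v ≤ c + 1) :
    ∑ a : {v : V // v ≠ z}, (if D.Adj a.1 z then deg (del D z) a else 0) ≤ deg D z * c := by
  have h1 : ∑ a : {v : V // v ≠ z}, (if D.Adj a.1 z then deg (del D z) a else 0) ≤
      ∑ a : {v : V // v ≠ z}, (if D.Adj a.1 z then c else 0) := by
    apply sum_le_sum
    intro a _
    by_cases h : D.Adj a.1 z
    · simp only [h, if_true]
      have := deg_del D z a
      simp only [h, if_true] at this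
      have := hcap a.1
      omega
    · simp only [h, if_false]
      exact le_refl 0
  have h2 : ∑ a : {v : V // v ≠ z}, (if D.Adj a.1 z then c else 0) =
      c * ∑ a : {v : V // v ≠ z}, (if D.Adj a.1 z then 1 else 0) := by
    rw [mul_sum]
    apply sum_congr rfl
    intro a _
    by_cases h : D.Adj a.1 z <;> simp [h]
  have h3 : ∑ a : {v : V // v ≠ z}, (if D.Adj a.1 z then 1 else 0) = deg D z := by
    unfold deg
    rw [sum_del z (fun v => if D.Adj v z then 1 else 0), ← sum_filter, card_eq_sum_ones]
    apply sum_congr _ (fun _ _ => rfl)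
    ext w
    simp only [mem_filter, mem_erase, mem_univ, true_and, and_true]
    constructor
    · rintro ⟨-, h⟩; exact h.symm
    · intro h; exact ⟨h.ne.symm, h.symm⟩
  rw [h2, h3] at h1
  rw [mul_comm]
  exact h1

omit [DecidableEq V] in
/-- **EVERY DEGREE `≥ a` UNDER THE CAP `d ≤ k − a`:** `m + a² + r = a k`, `r + 2a ≤ k` ⇒
`Σ_v d(v)² + r (k − 1 − r) ≤ m k`. -/
theorem band_stability_of_min_degree (D : SimpleGraph V) [DecidableRel D.Adj] (a r : ℕ) (ha : 1 ≤ a)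
    (hcap : ∀ v, deg D v + a ≤ Fintype.card V) (hdeg : ∀ z, a ≤ deg D z)
    (hk : r + 2 * a ≤ Fintype.card V) (hm : D.edgeFinset.card + a * a + r = a * Fintype.card V) :
    ∑ v, deg D v * deg D v + r * (Fintype.card V - 1 - r) ≤ D.edgeFinset.card * Fintype.card V := by
  have hsum := sum_deg_eq D
  obtain ⟨f, hf⟩ : ∃ f : V → ℕ, ∀ v, deg D v = f v + a :=
    ⟨fun v => deg D v - a, fun v => (Nat.sub_add_cancel (hdeg v)).symm⟩
  have e1 : ∑ v, deg D v = ∑ v, f v + a * Fintype.card V := by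
    rw [sum_congr rfl (fun v _ => hf v), sum_add_distrib, sum_const, smul_eq_mul, card_univ]
    ring
  have e2 : ∀ v, deg D v * deg D v = f v * f v + 2 * a * f v + a * a := fun v => by rw [hf v]; ring
  have e3 : ∑ v, deg D v * deg D v = ∑ v, f v * f v + 2 * a * ∑ v, f v + a * a * Fintype.card V := by
    rw [sum_congr rfl (fun v _ => e2 v), sum_add_distrib, sum_add_distrib, ← mul_sum, sum_const, smul_eq_mul,
      card_univ]
    ring
  have hfcap : ∀ v, f v + 2 * a ≤ Fintype.card V := fun v => by have := hcap v; rw [hf v] at this; omega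
  have hA := sum_sq_le_mul_sum f (Fintype.card V - 2 * a) (fun v => by have := hfcap v; omega)
  obtain ⟨t, ht⟩ : ∃ t, Fintype.card V = r + 2 * a + t := ⟨Fintype.card V - (r + 2 * a), by omega⟩
  rw [e3, ht]
  have e4 : r + 2 * a + t - 1 - r = 2 * a + t - 1 := by omega
  have e5 : r + 2 * a + t - 2 * a = r + t := by omega
  rw [e4]
  rw [ht, e5] at hA
  rw [ht] at e1 hm
  generalize hS2 : ∑ v, f v * f v = S2 at hA
  generalize hS1 : ∑ v, f v = S1 at hA e1
  generalize hM : D.edgeFinset.card = M at hm hsum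
  have hs : S1 + a * (r + 2 * a + t) = 2 * M := by omega
  -- the products of the two linear identities with `k`
  have hsk : (S1 + a * (r + 2 * a + t)) * (r + 2 * a + t) = 2 * M * (r + 2 * a + t) := by rw [hs]
  have hmk : (M + a * a + r) * (r + 2 * a + t) = a * (r + 2 * a + t) * (r + 2 * a + t) := by rw [hm]
  obtain ⟨a', rfl⟩ : ∃ a', a = a' + 1 := ⟨a - 1, by omega⟩
  have e6 : 2 * (a' + 1) + t - 1 = 2 * a' + 1 + t := by omega
  rw [e6]
  nlinarith

/-- The arithmetic of the within-row deletion (`a = d + 1 + t`, `r = u + 1 + t`, `k − 1 = 2d + 3t + u + 2 + j`):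
the slack is `2tu`. -/
theorem band_low_degree_arith (d t u j S T m' : ℕ)
    (hrow : S + u * (2 * d + 3 * t + 1 + j) ≤ m' * (2 * d + 3 * t + u + 2 + j))
    (hT : T ≤ d * (d + 2 * t + u + 1 + j))
    (hm : m' + d + (d + 1 + t) * (d + 1 + t) + (u + 1 + t) = (d + 1 + t) * (2 * d + 3 * t + u + 2 + j + 1)) :
    S + 2 * T + d + d * d + (u + 1 + t) * (2 * d + 2 * t + 1 + j) ≤
      (m' + d) * (2 * d + 3 * t + u + 2 + j + 1) := by
  have key : 2 * d * (d + 2 * t + u + 1 + j) + d * d + (u + 1 + t) * (2 * d + 2 * t + 1 + j) + d +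
      (d + 1 + t) * (d + 1 + t) + (u + 1 + t) ≤
      (d + 1 + t) * (2 * d + 3 * t + u + 2 + j + 1) + d * (2 * d + 3 * t + u + 2 + j) +
        u * (2 * d + 3 * t + 1 + j) := by
    nlinarith [Nat.zero_le (t * u)]
  nlinarith [hrow, hT, key, hm]

/-- The arithmetic of the cross-row deletion (`a = r + d + 1 + t`, `k − 1 = 3r + 2d + 1 + 2t + j`): the slack is
`r + 2d + 1 + 2t + j + rt + 2dt + t² + tj`. -/
theorem band_low_degree_cross_arith (r d t j S T m' : ℕ)
    (henv : S ≤ m' * (3 * r + 2 * d + 1 + 2 * t + j)) (hT : T ≤ d * (2 * r + d + t + j))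
    (hm : m' + d + (r + d + 1 + t) * (r + d + 1 + t) + r =
      (r + d + 1 + t) * (3 * r + 2 * d + 1 + 2 * t + j + 1)) :
    S + 2 * T + d + d * d + r * (2 * r + 2 * d + 1 + 2 * t + j) ≤
      (m' + d) * (3 * r + 2 * d + 1 + 2 * t + j + 1) := by
  have key : 2 * d * (2 * r + d + t + j) + d + d * d + r * (2 * r + 2 * d + 1 + 2 * t + j) + d +
      (r + d + 1 + t) * (r + d + 1 + t) + r ≤
      (r + d + 1 + t) * (3 * r + 2 * d + 1 + 2 * t + j + 1) + d * (3 * r + 2 * d + 1 + 2 * t + j) + d := by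
    nlinarith [Nat.zero_le (r * t), Nat.zero_le (d * t), Nat.zero_le (t * t), Nat.zero_le (t * j)]
  nlinarith [henv, hT, key, hm]

/-- **A VERTEX OF LOW DEGREE, WITHIN THE ROW:** `d(z) ≤ a − 1`, `r + d(z) ≥ a`, the cap `d ≤ k − a`, and the
row `r + d(z) − a` on `D − z` ⇒ the cell `r` of the row `a` at `k`. -/
theorem band_of_low_degree (D : SimpleGraph V) [DecidableRel D.Adj] (a r : ℕ)
    (hcap : ∀ v, deg D v + a ≤ Fintype.card V) {z : V} (hd : deg D z + 1 ≤ a) (hrd : a ≤ r + deg D z)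
    (hk : r + 2 * a ≤ Fintype.card V) (hm : D.edgeFinset.card + a * a + r = a * Fintype.card V)
    (hrow : ∑ v, deg (del D z) v * deg (del D z) v +
        (r + deg D z - a) * (Fintype.card {v : V // v ≠ z} - 1 - (r + deg D z - a)) ≤
      (del D z).edgeFinset.card * Fintype.card {v : V // v ≠ z}) :
    ∑ v, deg D v * deg D v + r * (Fintype.card V - 1 - r) ≤ D.edgeFinset.card * Fintype.card V := by
  have hcard := card_del z
  have hedges := card_edges_del D z
  have hsq := sum_deg_sq_del D z
  have hT := sum_del_nbhd_le D z (Fintype.card V - a - 1) (fun v => by have := hcap v; omega)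
  obtain ⟨k', hk'⟩ : ∃ k', Fintype.card {v : V // v ≠ z} = k' := ⟨_, rfl⟩
  obtain ⟨m', hm'⟩ : ∃ m', (del D z).edgeFinset.card = m' := ⟨_, rfl⟩
  obtain ⟨d, hdz⟩ : ∃ d, deg D z = d := ⟨_, rfl⟩
  obtain ⟨T, hTT⟩ : ∃ T, ∑ a : {v : V // v ≠ z}, (if D.Adj a.1 z then deg (del D z) a else 0) = T := ⟨_, rfl⟩
  obtain ⟨S, hS⟩ : ∃ S, ∑ v, deg (del D z) v * deg (del D z) v = S := ⟨_, rfl⟩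
  rw [hk'] at hcard hrow
  rw [hm'] at hedges hrow
  rw [hdz] at hedges hsq hT hd hrd hrow
  rw [hTT] at hsq hT
  rw [hS] at hsq hrow
  have hkV : Fintype.card V = k' + 1 := by omega
  have hmD : D.edgeFinset.card = m' + d := by omega
  rw [hkV, hmD]
  rw [hkV] at hm hT hk
  rw [hmD] at hm
  rw [hsq]
  -- the coordinates: `a = d + 1 + t`, `r = u + 1 + t`, `k = 2a + r + j`
  obtain ⟨t, rfl⟩ : ∃ t, a = d + 1 + t := ⟨a - (d + 1), by omega⟩
  obtain ⟨u, rfl⟩ : ∃ u, r = u + 1 + t := ⟨r - (1 + t), by omega⟩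
  obtain ⟨j, rfl⟩ : ∃ j, k' = 2 * d + 3 * t + u + 2 + j := ⟨k' - (2 * d + 3 * t + u + 2), by omega⟩
  have e1 : u + 1 + t + d - (d + 1 + t) = u := by omega
  have e2 : 2 * d + 3 * t + u + 2 + j - 1 - u = 2 * d + 3 * t + 1 + j := by omega
  have e3 : 2 * d + 3 * t + u + 2 + j + 1 - 1 - (u + 1 + t) = 2 * d + 2 * t + 1 + j := by omega
  have e4 : 2 * d + 3 * t + u + 2 + j + 1 - (d + 1 + t) - 1 = d + 2 * t + u + 1 + j := by omega
  rw [e1, e2] at hrow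
  rw [e3]
  rw [e4] at hT
  have := band_low_degree_arith d t u j S T m' hrow hT hm
  linarith

/-- **A VERTEX OF LOW DEGREE, ACROSS THE ROW:** `r + d(z) ≤ a − 1` with the cap `d ≤ k − a`: the envelope at
`k − 1` on `D − z` gives the cell `r` of the row `a` at `k` (`k ≥ 7`). -/
theorem band_of_low_degree_cross (D : SimpleGraph V) [DecidableRel D.Adj] (hK : K4mFree D) (a r : ℕ)
    (hcap : ∀ v, deg D v + a ≤ Fintype.card V) {z : V} (hrd : r + deg D z + 1 ≤ a)
    (hk : r + 2 * a ≤ Fintype.card V) (hk7 : 7 ≤ Fintype.card V)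
    (hm : D.edgeFinset.card + a * a + r = a * Fintype.card V) :
    ∑ v, deg D v * deg D v + r * (Fintype.card V - 1 - r) ≤ D.edgeFinset.card * Fintype.card V := by
  have hcard := card_del z
  have hedges := card_edges_del D z
  have hsq := sum_deg_sq_del D z
  have hT := sum_del_nbhd_le D z (Fintype.card V - a - 1) (fun v => by have := hcap v; omega)
  have hK' := k4mFree_del D hK z
  have henv := sum_deg_sq_le_of_k4mFree (del D z) hK' (by omega)
  obtain ⟨k', hk'⟩ : ∃ k', Fintype.card {v : V // v ≠ z} = k' := ⟨_, rfl⟩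
  obtain ⟨m', hm'⟩ : ∃ m', (del D z).edgeFinset.card = m' := ⟨_, rfl⟩
  obtain ⟨d, hdz⟩ : ∃ d, deg D z = d := ⟨_, rfl⟩
  obtain ⟨T, hTT⟩ : ∃ T, ∑ a : {v : V // v ≠ z}, (if D.Adj a.1 z then deg (del D z) a else 0) = T := ⟨_, rfl⟩
  obtain ⟨S, hS⟩ : ∃ S, ∑ v, deg (del D z) v * deg (del D z) v = S := ⟨_, rfl⟩
  rw [hk'] at hcard henv
  rw [hm'] at hedges henv
  rw [hdz] at hedges hsq hT hrd
  rw [hTT] at hsq hT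
  rw [hS] at hsq henv
  have hkV : Fintype.card V = k' + 1 := by omega
  have hmD : D.edgeFinset.card = m' + d := by omega
  rw [hkV, hmD]
  rw [hkV] at hm hT hk
  rw [hmD] at hm
  rw [hsq]
  -- the coordinates: `a = r + d + 1 + t`, `k = 2a + r + j`
  obtain ⟨t, rfl⟩ : ∃ t, a = r + d + 1 + t := ⟨a - (r + d + 1), by omega⟩
  obtain ⟨j, rfl⟩ : ∃ j, k' = 3 * r + 2 * d + 1 + 2 * t + j := ⟨k' - (3 * r + 2 * d + 1 + 2 * t), by omega⟩
  have e3 : 3 * r + 2 * d + 1 + 2 * t + j + 1 - 1 - r = 2 * r + 2 * d + 1 + 2 * t + j := by omega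
  have e4 : 3 * r + 2 * d + 1 + 2 * t + j + 1 - (r + d + 1 + t) - 1 = 2 * r + d + t + j := by omega
  rw [e3]
  rw [e4] at hT
  have := band_low_degree_cross_arith r d t j S T m' henv hT hm
  linarith

end C047

end TriangleCap

end PercRepro
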